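import Mathlib
import Summits.NavierStokesRegularity.NavierStokesRegularity.Theorems.FilamentSkeletonRssSkeletonJ1RLiaShooting

/-!
# Route `FilamentSkeletonRss` · crux `SkeletonJ1R` (stmt-NavierStokesRegularity-23610) · registered line `streamline_kantorovich_R`
# — brick F(i)-d for stub F1 `LiaFrameExistsL`: SKEW-LINE GEOMETRY — a near-straight arc shot from the waist of datum line `j` stays
# `(ρ/2)√Γ` away from every partner datum line

Lead `ns-fsr-lead-23610` (g0), `--supports stmt-NavierStokesRegularity-23610 --as helper`; route-independent, Γ-explicit, no line-vocabulary import.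

WHY.  The curvature of the LIA reference is `β⁻¹ φ(x) x′ × W(x)` with `W` the partners' line fields + frame field; `‖W(x τ)‖` is `O(√Γ + ‖x τ‖)`
only while `x τ` stays at distance `≳ ρ√Γ` from the partner lines (`norm_lineField_le`, `norm_ambientField_le`).  This file proves the Γ-free
geometry that feeds the near-straightness bootstrap (`…SkeletonJ1RLiaBootstrap`):

* `norm_perpTo_sq`, `norm_perpTo_le` — the component of `v` orthogonal to a unit vector `t`, `v − ⟪v,t⟫t` (written out, no new definition):
  `‖·‖² = ‖v‖² − ⟪v,t⟫²`, 1-Lipschitz;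
* `skew_quadratic_lower` — for unit `t_j, t_k` in general position `|⟪t_j, t_k⟫| ≤ 1 − θd` (`0 < θd ≤ 1`) and any `v`,
  `‖(v + u t_j) − ⟪v + u t_j, t_k⟫t_k‖² ≥ θd u² − 4‖v‖|u|`: skew lines diverge linearly;
* `dist_partner_ge_of_nearStraightOn` — THE STATEMENT USED BY F1: if the datum lines `j ≠ k` (base points `q_j, q_k`, unit directions, general
  position `θd`, separation `ρ`: `ρ ≤ ‖q_j + a t_j − (q_k + b t_k)‖` for all `a, b`) are scaled by `√Γ`, and a `C¹` arc `x` with `x 0 = √Γ q_j`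
  has tilt `‖x′ − t_j‖ ≤ θ` on `[0, T]` with `θ ≤ min (√(θd/2)/2) (θd ρ/(16(‖q_j − q_k‖ + ρ)))`, then for every `τ ∈ [0, T]` the point `x τ` is at
  (perpendicular) distance `≥ (ρ/2)√Γ` from the scaled line `k`: `((ρ/2)√Γ)² ≤ ‖x τ − √Γ q_k‖² − ⟪x τ − √Γ q_k, t_k⟫²`.

HONEST FRAMING.  Elementary geometry for the ∃-side of a HYPOTHETICAL filament-type rotating-self-similar blow-up skeleton (MODEL rung, negative side);
nothing here is a claim about Navier–Stokes regularity or blow-up; stub F1 and the crux stay OPEN.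
-/

set_option linter.dupNamespace false -- `NavierStokesRegularity.NavierStokesRegularity` path/namespace repetition is the tree convention

noncomputable section

namespace Summit.NavierStokesRegularity.NavierStokesRegularity.Theorems.SkeletonJ1RFrame

open Set Function Filter Real Topology
open scoped InnerProductSpace

/-! ## §1 The component orthogonal to a unit vector -/

/-- The perpendicular component `v ↦ v − ⟪v, t⟫t` is additive. [folklore] -/
theorem perpTo_add (t v w : EuclideanSpace ℝ (Fin 3)) : ((v + w) - (inner ℝ (v + w) t) • t) = ((v) - (inner ℝ (v) t) • t) + ((w) - (inner ℝ (w) t) • t) := by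
  rw [inner_add_left, add_smul]; abel

/-- The perpendicular component `v ↦ v − ⟪v, t⟫t` commutes with scalars. [folklore] -/
theorem perpTo_smul (t v : EuclideanSpace ℝ (Fin 3)) (c : ℝ) : ((c • v) - (inner ℝ (c • v) t) • t) = c • ((v) - (inner ℝ (v) t) • t) := by
  rw [inner_smul_left, RCLike.conj_to_real, smul_sub, smul_smul]

/-- `‖v − ⟪v, t⟫t‖² = ‖v‖² − ⟪v, t⟫²` for a unit vector `t` (Pythagoras). [folklore] -/
theorem norm_perpTo_sq (t v : EuclideanSpace ℝ (Fin 3)) (ht : ‖t‖ = 1) : ‖((v) - (inner ℝ (v) t) • t)‖ ^ 2 = ‖v‖ ^ 2 - (inner ℝ v t) ^ 2 := by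
  rw [norm_sub_sq_real, inner_smul_right, norm_smul, Real.norm_eq_abs, ht, mul_one, sq_abs]
  ring

/-- `‖v − ⟪v, t⟫t‖ ≤ ‖v‖` for a unit vector `t`. [folklore] -/
theorem norm_perpTo_le (t v : EuclideanSpace ℝ (Fin 3)) (ht : ‖t‖ = 1) : ‖((v) - (inner ℝ (v) t) • t)‖ ≤ ‖v‖ := by
  have h := norm_perpTo_sq t v ht
  nlinarith [sq_nonneg (inner ℝ v t), norm_nonneg (((v) - (inner ℝ (v) t) • t)), norm_nonneg v]

/-- The perpendicular component realises the distance to the line: `‖v − ⟪v, t⟫t‖ ≤ ‖v − b t‖` for every `b` (unit `t`). [folklore] -/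
theorem norm_perpTo_le_norm_sub_smul (t v : EuclideanSpace ℝ (Fin 3)) (ht : ‖t‖ = 1) (b : ℝ) : ‖((v) - (inner ℝ (v) t) • t)‖ ≤ ‖v - b • t‖ := by
  have h1 := norm_perpTo_sq t v ht
  have h2 : ‖v - b • t‖ ^ 2 = (b - inner ℝ v t) ^ 2 + (‖v‖ ^ 2 - (inner ℝ v t) ^ 2) := by
    rw [norm_sub_sq_real, inner_smul_right, norm_smul, Real.norm_eq_abs, ht, mul_one, sq_abs]; ring
  nlinarith [sq_nonneg (b - inner ℝ v t), norm_nonneg (((v) - (inner ℝ (v) t) • t)), norm_nonneg (v - b • t)]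

/-! ## §2 Skew lines diverge linearly -/

/-- **Skew quadratic lower bound.**  For unit vectors `t_j, t_k` with `|⟪t_j, t_k⟫| ≤ 1 − θd` (`0 < θd ≤ 1`) and any `v`, `u`:
`‖(v + u t_j) − ⟪v + u t_j, t_k⟫t_k‖² ≥ θd u² − 4 ‖v‖ |u|`. [folklore] -/
theorem skew_quadratic_lower (tj tk v : EuclideanSpace ℝ (Fin 3)) (htj : ‖tj‖ = 1) (htk : ‖tk‖ = 1) {θd : ℝ} (hθd : 0 < θd)
    (hθd1 : θd ≤ 1) (hgp : |inner ℝ tj tk| ≤ 1 - θd) (u : ℝ) :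
    θd * u ^ 2 - 4 * ‖v‖ * |u| ≤ ‖((v + u • tj) - (inner ℝ (v + u • tj) tk) • tk)‖ ^ 2 := by
  rw [norm_perpTo_sq tk _ htk]
  set c := inner ℝ tj tk with hc
  set a := inner ℝ v tj with ha
  set b := inner ℝ v tk with hb
  have hexp : ‖v + u • tj‖ ^ 2 - (inner ℝ (v + u • tj) tk) ^ 2 =
      (‖v‖ ^ 2 - b ^ 2) + 2 * u * (a - c * b) + u ^ 2 * (1 - c ^ 2) := by
    rw [norm_add_sq_real, inner_add_left, inner_smul_left, RCLike.conj_to_real, inner_smul_right, norm_smul, Real.norm_eq_abs,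
      htj, mul_one, sq_abs, ← ha, ← hb, ← hc]
    ring
  rw [hexp]
  have hb2 : b ^ 2 ≤ ‖v‖ ^ 2 := by
    have h : |b| ≤ ‖v‖ := by simpa [hb, htk] using abs_real_inner_le_norm v tk
    have h' := abs_le.mp h
    nlinarith
  have ha1 : |a| ≤ ‖v‖ := by simpa [ha, htj] using abs_real_inner_le_norm v tj
  have hb1 : |b| ≤ ‖v‖ := by simpa [hb, htk] using abs_real_inner_le_norm v tk
  have hc1 : |c| ≤ 1 - θd := hgp
  have hcc : 1 - c ^ 2 ≥ θd := by
    have : c ^ 2 ≤ (1 - θd) ^ 2 := by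
      have := abs_le.mp hc1; nlinarith [abs_nonneg c, sq_abs c]
    nlinarith
  -- |a - c b| ≤ 2‖v‖
  have hlin : |a - c * b| ≤ 2 * ‖v‖ := by
    have hcb : |c * b| ≤ ‖v‖ := by
      rw [abs_mul]
      have hc' : |c| ≤ 1 := by linarith [abs_nonneg c]
      calc |c| * |b| ≤ 1 * ‖v‖ := mul_le_mul hc' hb1 (abs_nonneg _) zero_le_one
        _ = ‖v‖ := one_mul _
    calc |a - c * b| ≤ |a| + |c * b| := abs_sub _ _
      _ ≤ ‖v‖ + ‖v‖ := add_le_add ha1 hcb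
      _ = 2 * ‖v‖ := by ring
  have hmid : -(4 * ‖v‖ * |u|) ≤ 2 * u * (a - c * b) := by
    have h1 : |2 * u * (a - c * b)| = 2 * |u| * |a - c * b| := by
      rw [abs_mul, abs_mul, abs_of_pos (by norm_num : (0:ℝ) < 2)]
    have h2 : |2 * u * (a - c * b)| ≤ 4 * ‖v‖ * |u| := by
      rw [h1]
      have := mul_le_mul_of_nonneg_left hlin (by positivity : 0 ≤ 2 * |u|)
      linarith
    linarith [neg_abs_le (2 * u * (a - c * b))]
  have hsq : θd * u ^ 2 ≤ u ^ 2 * (1 - c ^ 2) := by nlinarith [sq_nonneg u]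
  linarith

/-! ## §3 A near-straight arc from the waist of line `j` stays away from line `k` -/

/-- **Deviation from the datum line.**  If `x` is `C¹` with `‖x′ σ − t‖ ≤ θ` on `[0, T]`, then `‖x τ − (x 0 + τ • t)‖ ≤ θ τ` for `τ ∈ [0, T]`. [folklore] -/
theorem norm_sub_line_le_of_nearStraightOn {x : ℝ → EuclideanSpace ℝ (Fin 3)} (hx : ContDiff ℝ 1 x) {t : EuclideanSpace ℝ (Fin 3)}
    {θ T : ℝ} (hθ : ∀ σ ∈ Icc 0 T, ‖deriv x σ - t‖ ≤ θ) {τ : ℝ} (hτ : τ ∈ Icc 0 T) : ‖x τ - (x 0 + τ • t)‖ ≤ θ * τ := by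
  have hxd : Differentiable ℝ x := hx.differentiable (by norm_num)
  set f : ℝ → EuclideanSpace ℝ (Fin 3) := fun σ => x σ - σ • t with hf
  have hfd : ∀ σ, HasDerivAt f (deriv x σ - t) σ := fun σ => by
    have h1 : HasDerivAt (fun σ : ℝ => σ • t) ((1:ℝ) • t) σ := (hasDerivAt_id σ).smul_const t
    rw [one_smul] at h1
    exact (hxd σ).hasDerivAt.sub h1
  have h := Convex.norm_image_sub_le_of_norm_deriv_le (f := f) (fun σ _ => (hfd σ).differentiableAt)
    (fun σ hσ => by rw [(hfd σ).deriv]; exact hθ σ hσ) (convex_Icc 0 T) ⟨le_rfl, hτ.1.trans hτ.2⟩ hτ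
  simp only [hf, zero_smul, sub_zero, Real.norm_eq_abs, abs_of_nonneg hτ.1] at h
  calc ‖x τ - (x 0 + τ • t)‖ = ‖x τ - τ • t - x 0‖ := by congr 1; abel
    _ ≤ θ * τ := h

/-- **Distance to a partner line along a near-straight arc.**  Datum lines `j ≠ k`: base points `q_j, q_k`, unit directions `t_j, t_k` in general
position `|⟪t_j,t_k⟫| ≤ 1 − θd` (`0 < θd ≤ 1`), separation `ρ ≤ ‖(q_j + a t_j) − (q_k + b t_k)‖` for all `a, b` (`ρ > 0`).  Scale by `√Γ` (any `Γ`; only `0 ≤ √Γ` is used).  If a `C¹` arc `x` with `x 0 = √Γ • q_j` has tilt `‖x′ − t_j‖ ≤ θ` on `[0, T]` with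
`0 ≤ θ ≤ min (√(θd/2)/2) (θd ρ / (16 (‖q_j − q_k‖ + ρ)))`, then for `τ ∈ [0, T]`:
`((ρ/2)√Γ)² ≤ ‖x τ − √Γ q_k‖² − ⟪x τ − √Γ q_k, t_k⟫²` (perpendicular distance `≥ (ρ/2)√Γ` from the scaled line `k`). [folklore] -/
theorem dist_partner_ge_of_nearStraightOn {x : ℝ → EuclideanSpace ℝ (Fin 3)} (hx : ContDiff ℝ 1 x)
    {qj qk tj tk : EuclideanSpace ℝ (Fin 3)} (htj : ‖tj‖ = 1) (htk : ‖tk‖ = 1) {θd ρ Γ θ T : ℝ} (hθd : 0 < θd) (hθd1 : θd ≤ 1)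
    (hgp : |inner ℝ tj tk| ≤ 1 - θd) (hρ : 0 < ρ) (hsep : ∀ a b : ℝ, ρ ≤ ‖(qj + a • tj) - (qk + b • tk)‖)
    (h0 : x 0 = Real.sqrt Γ • qj) (hθ0 : 0 ≤ θ) (hθ1 : θ ≤ Real.sqrt (θd / 2) / 2)
    (hθ2 : θ ≤ θd * ρ / (16 * (‖qj - qk‖ + ρ))) (htilt : ∀ σ ∈ Icc 0 T, ‖deriv x σ - tj‖ ≤ θ) {τ : ℝ} (hτ : τ ∈ Icc 0 T) :
    (ρ / 2 * Real.sqrt Γ) ^ 2 ≤ ‖x τ - Real.sqrt Γ • qk‖ ^ 2 - (inner ℝ (x τ - Real.sqrt Γ • qk) tk) ^ 2 := by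
  set s := Real.sqrt Γ with hs
  have hs0 : 0 ≤ s := Real.sqrt_nonneg Γ
  set v := qj - qk with hv
  set E := x τ - (x 0 + τ • tj) with hE
  have hEle : ‖E‖ ≤ θ * τ := norm_sub_line_le_of_nearStraightOn hx htilt hτ
  -- decomposition of `x τ − s qk`
  have hdec : x τ - s • qk = (s • v + τ • tj) + E := by
    rw [hE, h0, hv, smul_sub]; abel
  -- the perpendicular component
  rw [← norm_perpTo_sq tk _ htk, hdec, perpTo_add]
  -- lower bound for the unperturbed part
  have hmain : ρ / 2 * s + θ * τ ≤ ‖((s • v + τ • tj) - (inner ℝ (s • v + τ • tj) tk) • tk)‖ := by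
    by_cases hsmall : θ * τ ≤ ρ / 2 * s
    · -- short times: use the separation `ρ s`
      have hsepS : ρ * s ≤ ‖((s • v + τ • tj) - (inner ℝ (s • v + τ • tj) tk) • tk)‖ := by
        by_cases hs00 : s = 0
        · rw [hs00, mul_zero]; exact norm_nonneg _
        have hspos : 0 < s := lt_of_le_of_ne hs0 (Ne.symm hs00)
        -- perp ≥ distance realised: ‖perp (s v + τ tj)‖ = s ‖perp (v + (τ/s) tj)‖ ≥ s ρ
        have hscale : s • v + τ • tj = s • (v + (τ / s) • tj) := by
          rw [smul_add, smul_smul, mul_div_cancel₀ _ hs00]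
        rw [hscale, perpTo_smul, norm_smul, Real.norm_of_nonneg hs0, mul_comm ρ s]
        refine mul_le_mul_of_nonneg_left ?_ hs0
        have h := norm_perpTo_le_norm_sub_smul tk (v + (τ / s) • tj) htk (inner ℝ (v + (τ / s) • tj) tk)
        refine le_trans ?_ h
        have := hsep (τ / s) (inner ℝ (v + (τ / s) • tj) tk)
        rwa [hv, show qj + (τ / s) • tj - (qk + inner ℝ (qj - qk + (τ / s) • tj) tk • tk) =
          qj - qk + (τ / s) • tj - inner ℝ (qj - qk + (τ / s) • tj) tk • tk by abel] at this
      linarith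
    · -- long times: skew divergence
      push Not at hsmall
      have hθpos : 0 < θ := by
        by_contra h; push Not at h
        have : θ = 0 := le_antisymm h hθ0
        rw [this, zero_mul] at hsmall
        have : 0 ≤ ρ / 2 * s := by positivity
        linarith
      have hτpos : 0 < τ := by
        by_contra h; push Not at h
        have : θ * τ ≤ 0 := mul_nonpos_of_nonneg_of_nonpos hθ0 h
        have : 0 ≤ ρ / 2 * s := by positivity
        linarith
      -- from θ τ > ρ s /2 and θ ≤ θd ρ/(16(‖v‖+ρ)): τ θd ≥ 8 (‖v‖+ρ) s ≥ 8 ‖v‖ s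
      have hden : 0 < 16 * (‖v‖ + ρ) := by positivity
      have hτbig : 8 * ‖v‖ * s ≤ θd * τ := by
        have h1 : θ * (16 * (‖v‖ + ρ)) ≤ θd * ρ := (le_div_iff₀ hden).1 hθ2
        have e1 : θ * (16 * (‖v‖ + ρ)) * τ ≤ θd * ρ * τ := mul_le_mul_of_nonneg_right h1 hτpos.le
        have e2 : ρ / 2 * s * (16 * (‖v‖ + ρ)) < θ * τ * (16 * (‖v‖ + ρ)) := mul_lt_mul_of_pos_right hsmall hden
        have e3 : ρ * (8 * (‖v‖ + ρ) * s) < ρ * (θd * τ) := by linarith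
        have e4 : 8 * (‖v‖ + ρ) * s < θd * τ := lt_of_mul_lt_mul_left e3 hρ.le
        have : 0 ≤ ρ * s := by positivity
        nlinarith
      have hq := skew_quadratic_lower tj tk (s • v) htj htk hθd hθd1 hgp τ
      rw [norm_smul, Real.norm_of_nonneg hs0, abs_of_pos hτpos] at hq
      -- θd τ² − 4 s‖v‖ τ ≥ θd τ²/2
      have hq2 : θd / 2 * τ ^ 2 ≤ ‖((s • v + τ • tj) - (inner ℝ (s • v + τ • tj) tk) • tk)‖ ^ 2 := by nlinarith
      -- ⇒ ‖perp‖ ≥ √(θd/2) τ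
      have hc0 : 0 ≤ Real.sqrt (θd / 2) := Real.sqrt_nonneg _
      have hc2 : Real.sqrt (θd / 2) ^ 2 = θd / 2 := Real.sq_sqrt (by positivity)
      have hP : Real.sqrt (θd / 2) * τ ≤ ‖((s • v + τ • tj) - (inner ℝ (s • v + τ • tj) tk) • tk)‖ :=
        (pow_le_pow_iff_left₀ (by positivity) (norm_nonneg _) two_ne_zero).1 (by rw [mul_pow, hc2]; exact hq2)
      -- and (√(θd/2) − θ) τ ≥ (√(θd/2)/2) τ ≥ ρ s/2 + θ τ  since θ ≤ √(θd/2)/2 and θ τ > ρ s / 2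
      nlinarith [hP, hθ1, hτpos.le, hc0]
  -- perturbation by E
  have hpert : ‖((s • v + τ • tj) - (inner ℝ (s • v + τ • tj) tk) • tk)‖ - ‖E‖ ≤ ‖((s • v + τ • tj) - (inner ℝ (s • v + τ • tj) tk) • tk) + ((E) - (inner ℝ (E) tk) • tk)‖ := by
    have h1 : ‖((s • v + τ • tj) - (inner ℝ (s • v + τ • tj) tk) • tk)‖ ≤ ‖((s • v + τ • tj) - (inner ℝ (s • v + τ • tj) tk) • tk) + ((E) - (inner ℝ (E) tk) • tk)‖ + ‖((E) - (inner ℝ (E) tk) • tk)‖ := by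
      simpa using norm_sub_le (((s • v + τ • tj) - (inner ℝ (s • v + τ • tj) tk) • tk) + ((E) - (inner ℝ (E) tk) • tk)) (((E) - (inner ℝ (E) tk) • tk))
    have h2 := norm_perpTo_le tk E htk
    linarith
  have hfin : ρ / 2 * s ≤ ‖((s • v + τ • tj) - (inner ℝ (s • v + τ • tj) tk) • tk) + ((E) - (inner ℝ (E) tk) • tk)‖ := by linarith
  have h0le : 0 ≤ ρ / 2 * s := by positivity
  exact pow_le_pow_left₀ h0le hfin 2

end Summit.NavierStokesRegularity.NavierStokesRegularity.Theorems.SkeletonJ1RFrame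

end
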